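import Literature.Geometry.Kaehler.ComplexTorusSchollCorrespondenceInverseLefschetz
import HarnessLib

/-!
# Scholl's correspondence `f_i` is symmetric and is a two-sided inverse of the hard Lefschetz isomorphism
# (Milne 1999, Rem. 5.11, complements at torus level)

Layer `Literature/Geometry/Kaehler`, namespace `Literature.Geometry.Kaehler.ComplexTorus`; lane `lit-hodgefound`
(Track 2 foundations library), Layer A4, prover seat `lit-hodgefound-p08` (generation 11; FILE 2 of row g11-#2
«Milne 1999 Rem. 5.11, the operator clause, at torus level»). Sequel, BY NAME, of
`ComplexTorusSchollCorrespondenceInverseLefschetz` (g11-#2: `((-1)ⁱ g!/c) · f_i(·) = Λᵗ = kleimanDualPow`),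
`ComplexTorusKunnethDiagonalDivisorFormula` (Q1166: `σ^*` on the monomials, `pullG_prodComm_monomial`) and
`ComplexTorusInverseLefschetzKleiman` (g7-#3: `Lᵗ ∘ Λᵗ = id` on `H^{m+2t}`, `m + t = g`).

## Source, verbatim

J. S. Milne, *Lefschetz classes on abelian varieties*, Duke Math. J. **96** (1999), held
`paper:doi-10-1215-s0012-7094-99-09620-5`, p. 665 (p0027 L54–L79), Rem. 5.11: "Following (Scholl 1994, 5.9), define
for `0 ≤ i ≤ 2g`, `f_i = Σ_{max(0,i−g) ≤ j ≤ i/2} (1/(j!(g−i+j)!(i−2j)!)) p^*([Dʲ]) · q^*([Dʲ]) · [M]^{i−2j}`. Then `f_i` is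
Lefschetz, and `((−1)ⁱ/√deg(λ_D)) f_i` is the inverse of the strong Lefschetz isomorphism 'cup with `[D]^{g−i}`'."

## What is proved (torus level; theorems only, no definitions, no named facts)

For a complex torus `X = E/Φ(ℤ^ι)` of dimension `g` and a real invariant `2`-form `ξ` (`θ = ofRealForm ξ`):
* **`pullG_prodComm_schollF`: `σ^*f_i = f_i`** — Scholl's `f_i` (symmetric in `p^*[Dʲ] · q^*[Dʲ]`, and `σ^*[M] = [M]`)
  is a SYMMETRIC correspondence (`ᵗf_i = f_i`), in the graded ring of invariant forms on `X × X`;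
* **`lefschetzPow_comp_smul_corrAct_schollF`: `Lᵗ ∘ (((-1)ⁱ g!/c) · f_i) = id` on `H^{i+2t}(X) = H^{2g-i}(X)`**,
  `i + t = g`, for `ξ` non-degenerate with `θ^{∧g} = c · vol_X`, `c ≠ 0` — with g11-#2's
  `corrAct_schollF_comp_lefschetzPow` (`f_i ∘ Lᵗ = ((-1)ⁱ c/g!) · id` on `Hⁱ`) the rescaled `f_i` is the TWO-SIDED
  inverse of the hard Lefschetz isomorphism; polarised, printed normalisation:
  **`IsRiemannForm.lefschetzPow_comp_smul_corrAct_schollF`: `L^{g-i} ∘ (((-1)ⁱ/(d₁⋯d_g)) · f_i) = id` on `H^{2g-i}(X)`**.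

## References

* [Milne1999LefschetzClasses] J. S. Milne, *Lefschetz classes on abelian varieties*, Duke Math. J. 96 (1999), §5
  Rem. 5.11 (p. 665).
* [Lange2023AbelianVarietiesComplex] H. Lange, *Abelian Varieties over the Complex Numbers* (2023), §6.2.2 p. 304
  (transposed correspondences), §7.3.2.
-/

noncomputable section

open scoped Manifold ContDiff Topology Real
open Set Function Complex Finset Module
open Literature.LinearAlgebra.Alternating
open Literature.LinearAlgebra.Alternating.GForm (of pullG IsHomog)

namespace Literature.Geometry.Kaehler

namespace ComplexTorus

section Symmetric

variable {E : Type*} [NormedAddCommGroup E] [NormedSpace ℂ E] {g : ℕ}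

/-- **`ᵗf_i = f_i`: Scholl's correspondence is symmetric** — `σ^*f_i = f_i` in the graded ring of invariant forms on
`X × X`, `σ` the exchange of the factors (each monomial `p₁^*θʲ ∧ p₂^*θʲ ∧ μ^{i-2j}` is `σ`-invariant: `σ^*` exchanges
`p₁^*θ ↔ p₂^*θ` and fixes `μ`). [cite: Milne1999LefschetzClasses, §5 Rem. 5.11]
[cite: Lange2023AbelianVarietiesComplex, §6.2.2 p. 304] -/
theorem pullG_prodComm_schollF (ξ : E [⋀^Fin 2]→L[ℝ] ℝ) (i : ℕ) :
    pullG (ContinuousLinearEquiv.prodComm ℝ E E : E × E →L[ℝ] E × E)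
        (∑ j ∈ Finset.Icc (i - g) (i / 2),
          ((Nat.factorial j * Nat.factorial (g + j - i) * Nat.factorial (i - 2 * j) : ℕ) : ℂ)⁻¹ •
            ((of 2 ((ofRealForm ξ).compContinuousLinearMap (ContinuousLinearMap.fst ℝ E E)) : GForm (E × E) ℂ) ^ j *
          of 2 ((ofRealForm ξ).compContinuousLinearMap (ContinuousLinearMap.snd ℝ E E)) ^ j *
          of 2 (((ofRealForm ξ).compContinuousLinearMap (ContinuousLinearMap.fst ℝ E E +
              ContinuousLinearMap.snd ℝ E E)) -
            ((ofRealForm ξ).compContinuousLinearMap (ContinuousLinearMap.fst ℝ E E)) -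
            ((ofRealForm ξ).compContinuousLinearMap (ContinuousLinearMap.snd ℝ E E))) ^ (i - 2 * j))) =
      (∑ j ∈ Finset.Icc (i - g) (i / 2),
          ((Nat.factorial j * Nat.factorial (g + j - i) * Nat.factorial (i - 2 * j) : ℕ) : ℂ)⁻¹ •
            ((of 2 ((ofRealForm ξ).compContinuousLinearMap (ContinuousLinearMap.fst ℝ E E)) : GForm (E × E) ℂ) ^ j *
          of 2 ((ofRealForm ξ).compContinuousLinearMap (ContinuousLinearMap.snd ℝ E E)) ^ j *
          of 2 (((ofRealForm ξ).compContinuousLinearMap (ContinuousLinearMap.fst ℝ E E +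
              ContinuousLinearMap.snd ℝ E E)) -
            ((ofRealForm ξ).compContinuousLinearMap (ContinuousLinearMap.fst ℝ E E)) -
            ((ofRealForm ξ).compContinuousLinearMap (ContinuousLinearMap.snd ℝ E E))) ^ (i - 2 * j))) := by
  rw [map_sum]
  refine Finset.sum_congr rfl fun j _ ↦ ?_
  rw [GForm.pullG_smul_complex, pullG_prodComm_monomial]

end Symmetric

section TwoSided

variable {ι : Type*} [Fintype ι] [DecidableEq ι] {E : Type*} [NormedAddCommGroup E] [NormedSpace ℂ E]
  [FiniteDimensional ℂ E] (Φ : (ι → ℝ) ≃L[ℝ] E) {g : ℕ} (e : Fin (2 * g) ≃ ι) {ξ : E [⋀^Fin 2]→L[ℝ] ℝ}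

/-- **`Lᵗ ∘ (((-1)ⁱ g!/c) · f_i) = id` on `H^{i+2t}(X) = H^{2g-i}(X)`, `i + t = g`**: the rescaled Scholl correspondence is
also a RIGHT inverse of the hard Lefschetz isomorphism `Lᵗ : Hⁱ(X) ⥲ H^{2g-i}(X)` (it equals `Λᵗ`, g11-#2, and
`Lᵗ ∘ Λᵗ = id`, g7-#3). [cite: Milne1999LefschetzClasses, §5 Rem. 5.11] -/
theorem lefschetzPow_comp_smul_corrAct_schollF {c : ℂ} (hξ : wedgePow (ofRealForm ξ) g = c • volumeForm Φ e)
    (hc : c ≠ 0) (hnd : ∀ v : E, v ≠ 0 → ∃ w : E, ξ ![v, w] ≠ 0) {i t : ℕ} (hit : i + t = g)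
    (h : 2 * t + i = i + 2 * t) (e₁ : Fin ((i + 2 * t) + i) ≃ ι) :
    lefschetzPow ξ t h ∘ₗ
        (((-1) ^ i * Nat.factorial g / c : ℂ) •
          corrAct Φ Φ e₁
            (((∑ j ∈ Finset.Icc (i - g) (i / 2),
          ((Nat.factorial j * Nat.factorial (g + j - i) * Nat.factorial (i - 2 * j) : ℕ) : ℂ)⁻¹ •
            ((of 2 ((ofRealForm ξ).compContinuousLinearMap (ContinuousLinearMap.fst ℝ E E)) : GForm (E × E) ℂ) ^ j *
          of 2 ((ofRealForm ξ).compContinuousLinearMap (ContinuousLinearMap.snd ℝ E E)) ^ j *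
          of 2 (((ofRealForm ξ).compContinuousLinearMap (ContinuousLinearMap.fst ℝ E E +
              ContinuousLinearMap.snd ℝ E E)) -
            ((ofRealForm ξ).compContinuousLinearMap (ContinuousLinearMap.fst ℝ E E)) -
            ((ofRealForm ξ).compContinuousLinearMap (ContinuousLinearMap.snd ℝ E E))) ^ (i - 2 * j))) :
        GForm (E × E) ℂ) (i + i))) =
      LinearMap.id := by
  have hfr : i + t = finrank ℂ E := by have := finrank_complex_mul_two Φ e; omega
  rw [smul_corrAct_schollF_eq_kleimanDualPow Φ e hξ hc hnd hit e₁]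
  exact lefschetzPow_comp_kleimanDualPow hnd hfr h

variable {η : E [⋀^Fin 2]→L[ℝ] ℝ}

/-- **Polarised, printed normalisation: `L^{g-i} ∘ (((-1)ⁱ/(d₁⋯d_g)) · f_i) = id` on `H^{2g-i}(X)`** for a polarised
torus of type `(d₁, …, d_g)`, `ω = c₁(L) = ofRealForm (-η)`, `i + t = g` ("`((−1)ⁱ/√deg(λ_D)) f_i` is the inverse of
the strong Lefschetz isomorphism"). [cite: Milne1999LefschetzClasses, §5 Rem. 5.11] -/
theorem IsRiemannForm.lefschetzPow_comp_smul_corrAct_schollF (hη : IsRiemannForm Φ η) {d : Fin g → ℕ}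
    (hd : IsPolarizationType Φ η d) {i t : ℕ} (hit : i + t = g) (h : 2 * t + i = i + 2 * t)
    (e₁ : Fin ((i + 2 * t) + i) ≃ ι) :
    lefschetzPow (-η) t h ∘ₗ
        (((-1 : ℂ) ^ i / ∏ k, (d k : ℂ)) •
          corrAct Φ Φ e₁
            (((∑ j ∈ Finset.Icc (i - g) (i / 2),
          ((Nat.factorial j * Nat.factorial (g + j - i) * Nat.factorial (i - 2 * j) : ℕ) : ℂ)⁻¹ •
            ((of 2 ((ofRealForm (-η)).compContinuousLinearMap (ContinuousLinearMap.fst ℝ E E)) : GForm (E × E) ℂ) ^ j *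
          of 2 ((ofRealForm (-η)).compContinuousLinearMap (ContinuousLinearMap.snd ℝ E E)) ^ j *
          of 2 (((ofRealForm (-η)).compContinuousLinearMap (ContinuousLinearMap.fst ℝ E E +
              ContinuousLinearMap.snd ℝ E E)) -
            ((ofRealForm (-η)).compContinuousLinearMap (ContinuousLinearMap.fst ℝ E E)) -
            ((ofRealForm (-η)).compContinuousLinearMap (ContinuousLinearMap.snd ℝ E E))) ^ (i - 2 * j))) :
        GForm (E × E) ℂ) (i + i))) =
      LinearMap.id := by
  have hfr : i + t = finrank ℂ E := by have := finrank_complex_mul_two Φ e₁; omega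
  have hnd : ∀ v : E, v ≠ 0 → ∃ w : E, (-η) ![v, w] ≠ 0 := fun v hv ↦ by
    obtain ⟨w, hw⟩ := hη.exists_apply_ne_zero Φ v hv
    exact ⟨w, by rwa [ContinuousAlternatingMap.neg_apply, neg_ne_zero]⟩
  rw [hη.smul_corrAct_schollF_eq_kleimanDualPow Φ hd hit e₁]
  exact lefschetzPow_comp_kleimanDualPow hnd hfr h

end TwoSided

end ComplexTorus

end Literature.Geometry.Kaehler
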